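import Summits.CriticalPhenomena.PercolationContinuityZ3.Theorems.PercNearOneGluingNoHeavyLowerTailSetPortMergeWeights
import Summits.CriticalPhenomena.PercolationContinuityZ3.Theorems.PercNearOneGluingNoHeavyLowerTailCILInduction
import HarnessLib

/-!
# `NoHeavyLowerTail` (stmt-CriticalPhenomena-4575) — set-champion stability of a relay-neighboured Steiner SET from
# port domination in the glued graph

Support file (prover `prim-hp-6`, hull-port cell; `--supports stmt-CriticalPhenomena-4575`).  No definitions, no named
facts, no sorries.  Notation (`μ_w = prodBernoulli w` on `Fin n`, relays `A`, level `j`): for a vertex set `U` disjoint from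
`A`, `π(U) = {z ∈ A : z ↔ some x ∈ U}`, `bad_w(U) = μ_w{1 ≤ |π(U)| ≤ j}`, the set-champion-stability inequality
`CS_w(U, c) : μ_w(c ↮ U, 1 ≤ |π(U)| ≤ j) ≤ μ_w(c ↮ U, |π(c)| ≤ j)`, and the GLUED LIGHTNESS
`J_w(U, y) = μ_w(y ↮ U, |π(y)| ≤ j) + μ_w(y ↔ U, |π(U)| ≤ j)` (the lightness of `y` after contracting `U` to a point;
`Theorems.bad_le_glued_iff_setCS`, prover `prim-gen-induct`).  `U` is RELAY-NEIGHBOURED if every positive pair from `U` to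
its outside ends in `A` (its PORTS).

* `SetPort.exists_merged` — the merged weights `w♯` of `SetPort.real_eq_of_merged` exist.
* `SetPort.real_bad_eq_anchor`, `SetPort.glued_eq_lightness_anchor` — under `w♯` the set events of `U` are (on the
  support event) the single-observer events of the anchor `u₁`: `bad_w(U) = bad_{w♯}(u₁)` and `J_w(U, y) = I_{w♯}(y)`.
* `SetPort.setBad_le_glued_of_portDomination` — **transport of `Theorems.cil_of_portDomination`:** if `U` is
  relay-neighboured with at least one port and `J_w(U, p) ≤ J_w(U, c)` for every port `p`, then `bad_w(U) ≤ J_w(U, c)`;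
  hence (`setCS_of_gluedPortDomination`) `CS_w(U, c)` for `c ∈ A`.
This is the formal half of the seat's reduction "RN-set wall ⟸ glued port domination" (crux evidence HP6-MEMO2-SDX-UGD.md).
CAVEAT (memo §H): the hypothesis — the champion dominates the ports of a light relay-neighboured set after gluing — holds in
all but a handful of ~3·10⁴ exact checks but is NOT a theorem (explicit 8-vertex failure by 2.8·10⁻⁵, where the wall itself holds
with margin 0.25); so these are CONDITIONAL reductions (certificates), complemented by the unconditional case
`SetPort.setCS_of_offBest` in `…SetPortStripping.lean`.
-/

noncomputable section

namespace Summit.CriticalPhenomena.PercolationContinuityZ3.Theorems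

open MeasureTheory Set Literature.Probability.LatticeModels Literature.Probability.Percolation
open scoped Classical BigOperators

variable {n : ℕ}

namespace SetPort

/-! ### The merged weights exist -/

/-- The merged weight function of `SetPort.real_eq_of_merged` exists (`u₁ ∈ U`): `w` off `U`, the merged coins
`1 − ∏_{x ∈ U}(1 − w s(x,v))` on the anchor's outside pairs, `0` on every other pair meeting `U`. [folklore] -/
theorem exists_merged (w : Sym2 (Fin n) → unitInterval) (U : Finset (Fin n)) {u₁ : Fin n} (hu₁ : u₁ ∈ U) :
    ∃ wm : Sym2 (Fin n) → unitInterval,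
      (∀ e : Sym2 (Fin n), (∀ u ∈ U, u ∉ e) → wm e = w e) ∧
      (∀ e : Sym2 (Fin n), (∃ u ∈ U, u ∈ e) → (¬ ∃ v : Fin n, v ∉ U ∧ e = s(u₁, v)) → wm e = 0) ∧
      (∀ v : Fin n, v ∉ U → (1 - (wm s(u₁, v) : ℝ)) = ∏ x ∈ U, (1 - (w s(x, v) : ℝ))) := by
  have hprod : ∀ v : Fin n, (1 - ∏ x ∈ U, (1 - (w s(x, v) : ℝ))) ∈ unitInterval := by
    intro v
    have h0 : 0 ≤ ∏ x ∈ U, (1 - (w s(x, v) : ℝ)) :=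
      Finset.prod_nonneg fun x _ => sub_nonneg.2 (w s(x, v)).2.2
    have h1 : ∏ x ∈ U, (1 - (w s(x, v) : ℝ)) ≤ 1 :=
      Finset.prod_le_one (fun x _ => sub_nonneg.2 (w s(x, v)).2.2) fun x _ => sub_le_self _ (w s(x, v)).2.1
    exact ⟨by linarith, by linarith⟩
  refine ⟨fun e => if (∀ u ∈ U, u ∉ e) then w e else
      if h : (∃ v : Fin n, v ∉ U ∧ e = s(u₁, v)) then ⟨_, hprod (Classical.choose h)⟩ else 0, ?_, ?_, ?_⟩
  · intro e he; dsimp only; rw [if_pos he]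
  · intro e he hne
    have h1 : ¬ (∀ u ∈ U, u ∉ e) := by
      intro h; obtain ⟨u, hu, hue⟩ := he; exact h u hu hue
    simp [h1, hne]
  · intro v hv
    have h1 : ¬ (∀ u ∈ U, u ∉ s(u₁, v)) := fun h => h u₁ hu₁ (Sym2.mem_mk_left u₁ v)
    have h2 : ∃ v' : Fin n, v' ∉ U ∧ s(u₁, v) = s(u₁, v') := ⟨v, hv, rfl⟩
    have hch : Classical.choose h2 = v := by
      have hs := (Classical.choose_spec h2).2
      rcases Sym2.eq_iff.1 hs with ⟨-, h⟩ | ⟨h, h'⟩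
      · exact h.symm
      · exact absurd (h' ▸ hu₁ : v ∈ U) hv
    simp only [h1, if_false, h2, dif_pos]
    rw [hch]; ring

/-! ### Under the merged weights, the set events are the anchor's events -/

/-- If every open pair meeting `U` is an outside pair of the anchor, then a vertex `z ∉ U` is joined to some member iff
it is joined to the anchor. [folklore] -/
theorem exists_openConn_iff_anchor (U : Finset (Fin n)) {u₁ : Fin n} (hu₁ : u₁ ∈ U) {ω : BondConfig (Fin n)}
    (hω : ∀ e ∈ ω, (∃ u ∈ U, u ∈ e) → ∃ v : Fin n, v ∉ U ∧ e = s(u₁, v)) {z : Fin n} (hz : z ∉ U) :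
    (∃ x ∈ U, ω ∈ openConn x z) ↔ ω ∈ openConn u₁ z := by
  refine ⟨fun ⟨x, hx, hxz⟩ => ?_, fun h => ⟨u₁, hu₁, h⟩⟩
  obtain ⟨x', hx', v, hv, hxv, hreach⟩ := exists_exit_of_reachable U hx hz hxz
  obtain ⟨v', hv', he⟩ := hω _ hxv ⟨x', hx', Sym2.mem_mk_left x' v⟩
  have hvv : v = v' := by
    rcases Sym2.eq_iff.1 he with ⟨-, h⟩ | ⟨h, -⟩
    · exact h
    · exact absurd (h ▸ hx' : v' ∈ U) hv'
  subst hvv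
  exact reachable_of_exit U hu₁ hv (he ▸ hxv) hreach

/-- On the support event of the merged weights, every open pair meeting `U` is an outside pair of the anchor.
[folklore] -/
theorem anchor_of_support (wm : Sym2 (Fin n) → unitInterval) (U : Finset (Fin n)) (u₁ : Fin n)
    (hzero : ∀ e : Sym2 (Fin n), (∃ u ∈ U, u ∈ e) → (¬ ∃ v : Fin n, v ∉ U ∧ e = s(u₁, v)) → wm e = 0)
    {ω : BondConfig (Fin n)} (hω : ∀ e ∈ ω, wm e ≠ 0) :
    ∀ e ∈ ω, (∃ u ∈ U, u ∈ e) → ∃ v : Fin n, v ∉ U ∧ e = s(u₁, v) := by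
  intro e he hU
  by_contra hne
  exact hω e he (hzero e hU hne)

/-- `bad_w(U) = bad_{w♯}(u₁)` for the merged weights. [folklore] -/
theorem real_bad_eq_anchor (w wm : Sym2 (Fin n) → unitInterval) (A U : Finset (Fin n)) (hUA : Disjoint U A)
    {u₁ : Fin n} (hu₁ : u₁ ∈ U) (j : ℕ)
    (hoff : ∀ e : Sym2 (Fin n), (∀ u ∈ U, u ∉ e) → wm e = w e)
    (hzero : ∀ e : Sym2 (Fin n), (∃ u ∈ U, u ∈ e) → (¬ ∃ v : Fin n, v ∉ U ∧ e = s(u₁, v)) → wm e = 0)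
    (hcoin : ∀ v : Fin n, v ∉ U → (1 - (wm s(u₁, v) : ℝ)) = ∏ x ∈ U, (1 - (w s(x, v) : ℝ))) :
    (prodBernoulli w).real {ω : BondConfig (Fin n) |
        1 ≤ (A.filter fun z => ∃ x ∈ U, ω ∈ openConn x z).card ∧
        (A.filter fun z => ∃ x ∈ U, ω ∈ openConn x z).card ≤ j} =
      (prodBernoulli wm).real {ω : BondConfig (Fin n) |
        1 ≤ (A.filter fun z => ω ∈ openConn u₁ z).card ∧ (A.filter fun z => ω ∈ openConn u₁ z).card ≤ j} := by
  rw [real_eq_of_merged w wm U hu₁ (uStable_bad A U hUA j) hoff hzero hcoin,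
    ← CutObserver.measureReal_inter_support wm {ω : BondConfig (Fin n) |
        1 ≤ (A.filter fun z => ∃ x ∈ U, ω ∈ openConn x z).card ∧
        (A.filter fun z => ∃ x ∈ U, ω ∈ openConn x z).card ≤ j},
    ← CutObserver.measureReal_inter_support wm {ω : BondConfig (Fin n) |
        1 ≤ (A.filter fun z => ω ∈ openConn u₁ z).card ∧ (A.filter fun z => ω ∈ openConn u₁ z).card ≤ j}]
  congr 1
  ext ω
  simp only [mem_inter_iff, mem_setOf_eq]
  constructor
  · rintro ⟨h, hω⟩
    have hf : (A.filter fun z => ∃ x ∈ U, ω ∈ openConn x z) = (A.filter fun z => ω ∈ openConn u₁ z) :=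
      Finset.filter_congr fun z hz => exists_openConn_iff_anchor U hu₁ (anchor_of_support wm U u₁ hzero hω)
        (fun hzU => Finset.disjoint_left.1 hUA hzU hz)
    rw [hf] at h; exact ⟨h, hω⟩
  · rintro ⟨h, hω⟩
    have hf : (A.filter fun z => ∃ x ∈ U, ω ∈ openConn x z) = (A.filter fun z => ω ∈ openConn u₁ z) :=
      Finset.filter_congr fun z hz => exists_openConn_iff_anchor U hu₁ (anchor_of_support wm U u₁ hzero hω)
        (fun hzU => Finset.disjoint_left.1 hUA hzU hz)
    rw [hf]; exact ⟨h, hω⟩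

/-- `J_w(U, y) = I_{w♯}(y)` for the merged weights and `y ∉ U`: the glued lightness is the lightness under `w♯`.
[folklore] -/
theorem glued_eq_lightness_anchor (w wm : Sym2 (Fin n) → unitInterval) (A U : Finset (Fin n))
    (hUA : Disjoint U A) {u₁ : Fin n} (hu₁ : u₁ ∈ U) {y : Fin n} (hyU : y ∉ U) (j : ℕ)
    (hoff : ∀ e : Sym2 (Fin n), (∀ u ∈ U, u ∉ e) → wm e = w e)
    (hzero : ∀ e : Sym2 (Fin n), (∃ u ∈ U, u ∈ e) → (¬ ∃ v : Fin n, v ∉ U ∧ e = s(u₁, v)) → wm e = 0)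
    (hcoin : ∀ v : Fin n, v ∉ U → (1 - (wm s(u₁, v) : ℝ)) = ∏ x ∈ U, (1 - (w s(x, v) : ℝ))) :
    (prodBernoulli w).real {ω : BondConfig (Fin n) | (∀ x ∈ U, ω ∉ openConn y x) ∧
        (A.filter fun z => ω ∈ openConn y z).card ≤ j} +
      (prodBernoulli w).real {ω : BondConfig (Fin n) | (∃ x ∈ U, ω ∈ openConn y x) ∧
        (A.filter fun z => ∃ x ∈ U, ω ∈ openConn x z).card ≤ j} =
    (prodBernoulli wm).real {ω : BondConfig (Fin n) | (A.filter fun z => ω ∈ openConn y z).card ≤ j} := by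
  obtain ⟨-, hs2, hs3⟩ := uStable_events A U hUA y hyU j
  rw [real_eq_of_merged w wm U hu₁ hs2 hoff hzero hcoin, real_eq_of_merged w wm U hu₁ hs3 hoff hzero hcoin,
    ← CutObserver.glued_singleton wm A u₁ y j]
  have hsep : ∀ ω : BondConfig (Fin n), (∀ e ∈ ω, (∃ u ∈ U, u ∈ e) → ∃ v : Fin n, v ∉ U ∧ e = s(u₁, v)) →
      ((∃ x ∈ U, ω ∈ openConn y x) ↔ ω ∈ openConn y u₁) := by
    intro ω hω
    have key := exists_openConn_iff_anchor U hu₁ hω hyU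
    constructor
    · rintro ⟨x, hx, hyx⟩
      have : ∃ x ∈ U, ω ∈ openConn x y := ⟨x, hx, (show (openGraph ω).Reachable y x from hyx).symm⟩
      exact (show (openGraph ω).Reachable u₁ y from key.1 this).symm
    · intro h; exact ⟨u₁, hu₁, h⟩
  have e1 : ∀ ω : BondConfig (Fin n), (∀ e ∈ ω, wm e ≠ 0) →
      ((∀ x ∈ U, ω ∉ openConn y x) ↔ (∀ x ∈ ({u₁} : Finset (Fin n)), ω ∉ openConn y x)) := by
    intro ω hω
    simp only [Finset.mem_singleton, forall_eq]
    have h := hsep ω (anchor_of_support wm U u₁ hzero hω)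
    constructor
    · intro hall hy1; exact hall u₁ hu₁ hy1
    · intro h1 x hx hyx; exact h1 (h.1 ⟨x, hx, hyx⟩)
  have e2 : ∀ ω : BondConfig (Fin n), (∀ e ∈ ω, wm e ≠ 0) →
      ((∃ x ∈ U, ω ∈ openConn y x) ↔ (∃ x ∈ ({u₁} : Finset (Fin n)), ω ∈ openConn y x)) := by
    intro ω hω
    rw [hsep ω (anchor_of_support wm U u₁ hzero hω)]; simp only [Finset.mem_singleton, exists_eq_left]
  have hf : ∀ ω : BondConfig (Fin n), (∀ e ∈ ω, wm e ≠ 0) →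
      (A.filter fun z => ∃ x ∈ U, ω ∈ openConn x z) =
        (A.filter fun z => ∃ x ∈ ({u₁} : Finset (Fin n)), ω ∈ openConn x z) := by
    intro ω hω
    refine Finset.filter_congr fun z hz => ?_
    rw [exists_openConn_iff_anchor U hu₁ (anchor_of_support wm U u₁ hzero hω)
      (fun hzU => Finset.disjoint_left.1 hUA hzU hz)]
    simp only [Finset.mem_singleton, exists_eq_left]
  congr 1
  · rw [← CutObserver.measureReal_inter_support wm {ω : BondConfig (Fin n) | (∀ x ∈ U, ω ∉ openConn y x) ∧
        (A.filter fun z => ω ∈ openConn y z).card ≤ j},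
      ← CutObserver.measureReal_inter_support wm {ω : BondConfig (Fin n) |
        (∀ x ∈ ({u₁} : Finset (Fin n)), ω ∉ openConn y x) ∧ (A.filter fun z => ω ∈ openConn y z).card ≤ j}]
    congr 1; ext ω
    simp only [mem_inter_iff, mem_setOf_eq]
    constructor
    · rintro ⟨⟨h1, h2⟩, hω⟩; exact ⟨⟨(e1 ω hω).1 h1, h2⟩, hω⟩
    · rintro ⟨⟨h1, h2⟩, hω⟩; exact ⟨⟨(e1 ω hω).2 h1, h2⟩, hω⟩
  · rw [← CutObserver.measureReal_inter_support wm {ω : BondConfig (Fin n) | (∃ x ∈ U, ω ∈ openConn y x) ∧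
        (A.filter fun z => ∃ x ∈ U, ω ∈ openConn x z).card ≤ j},
      ← CutObserver.measureReal_inter_support wm {ω : BondConfig (Fin n) |
        (∃ x ∈ ({u₁} : Finset (Fin n)), ω ∈ openConn y x) ∧
        (A.filter fun z => ∃ x ∈ ({u₁} : Finset (Fin n)), ω ∈ openConn x z).card ≤ j}]
    congr 1; ext ω
    simp only [mem_inter_iff, mem_setOf_eq]
    constructor
    · rintro ⟨⟨h1, h2⟩, hω⟩; exact ⟨⟨(e2 ω hω).1 h1, by rw [← hf ω hω]; exact h2⟩, hω⟩
    · rintro ⟨⟨h1, h2⟩, hω⟩; exact ⟨⟨(e2 ω hω).2 h1, by rw [hf ω hω]; exact h2⟩, hω⟩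

/-! ### Port domination in the glued graph gives set-champion stability -/

/-- **Transport of `Theorems.cil_of_portDomination` to an observer SET.**  Let `U` be disjoint from `A` and
relay-neighboured (every positive pair from `U` to its outside ends in `A`), with at least one port, and let `c` be a
vertex such that `J_w(U, p) ≤ J_w(U, c)` for every port `p` (glued lightness).  Then `bad_w(U) ≤ J_w(U, c)`.
[cite: VandenbergHaggstromKahn2005, Thm. 1.5 (p. 7) — via `Theorems.cil_of_portDomination`] -/
theorem setBad_le_glued_of_portDomination (w : Sym2 (Fin n) → unitInterval) (A U : Finset (Fin n))
    (hUA : Disjoint U A) (c : Fin n) (hcU : c ∉ U) (j : ℕ)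
    (hRN : ∀ x ∈ U, ∀ v : Fin n, v ∉ U → w s(x, v) ≠ 0 → v ∈ A)
    (hport : ∃ x ∈ U, ∃ v : Fin n, v ∉ U ∧ w s(x, v) ≠ 0)
    (hdom : ∀ p ∈ A, (∃ x ∈ U, w s(x, p) ≠ 0) →
      (prodBernoulli w).real {ω : BondConfig (Fin n) | (∀ x ∈ U, ω ∉ openConn p x) ∧
          (A.filter fun z => ω ∈ openConn p z).card ≤ j} +
        (prodBernoulli w).real {ω : BondConfig (Fin n) | (∃ x ∈ U, ω ∈ openConn p x) ∧
          (A.filter fun z => ∃ x ∈ U, ω ∈ openConn x z).card ≤ j} ≤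
      (prodBernoulli w).real {ω : BondConfig (Fin n) | (∀ x ∈ U, ω ∉ openConn c x) ∧
          (A.filter fun z => ω ∈ openConn c z).card ≤ j} +
        (prodBernoulli w).real {ω : BondConfig (Fin n) | (∃ x ∈ U, ω ∈ openConn c x) ∧
          (A.filter fun z => ∃ x ∈ U, ω ∈ openConn x z).card ≤ j}) :
    (prodBernoulli w).real {ω : BondConfig (Fin n) |
        1 ≤ (A.filter fun z => ∃ x ∈ U, ω ∈ openConn x z).card ∧
        (A.filter fun z => ∃ x ∈ U, ω ∈ openConn x z).card ≤ j} ≤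
      (prodBernoulli w).real {ω : BondConfig (Fin n) | (∀ x ∈ U, ω ∉ openConn c x) ∧
          (A.filter fun z => ω ∈ openConn c z).card ≤ j} +
        (prodBernoulli w).real {ω : BondConfig (Fin n) | (∃ x ∈ U, ω ∈ openConn c x) ∧
          (A.filter fun z => ∃ x ∈ U, ω ∈ openConn x z).card ≤ j} := by
  obtain ⟨x₀, hx₀, v₀, hv₀, hxv₀⟩ := hport
  have hu₁ : x₀ ∈ U := hx₀
  obtain ⟨wm, hoff, hzero, hcoin⟩ := exists_merged w U hu₁
  -- the ports, enumerated
  set P : Finset (Fin n) := A.filter (fun v => ∃ x ∈ U, w s(x, v) ≠ 0) with hP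
  have hv₀P : v₀ ∈ P := by
    simp only [hP, Finset.mem_filter]; exact ⟨hRN x₀ hx₀ v₀ hv₀ hxv₀, x₀, hx₀, hxv₀⟩
  have hd : 0 < P.card := Finset.card_pos.2 ⟨v₀, hv₀P⟩
  set p : Fin P.card → Fin n := fun i => P.orderEmbOfFin rfl i with hp
  have hpinj : Function.Injective p := fun i i' h => (P.orderEmbOfFin rfl).injective h
  have hpP : ∀ l, p l ∈ P := fun l => Finset.orderEmbOfFin_mem P rfl l
  have hpA : ∀ l, p l ∈ A := fun l => (Finset.mem_filter.1 (hpP l)).1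
  have hx₀A : x₀ ∉ A := fun h => Finset.disjoint_left.1 hUA hx₀ h
  -- positive neighbours of the anchor under `wm` are ports
  have hobs : ∀ v, wm s(x₀, v) ≠ 0 → ∃ l, v = p l := by
    intro v hv
    have hvU : v ∉ U := by
      intro hvU
      exact hv (hzero _ ⟨x₀, hx₀, Sym2.mem_mk_left x₀ v⟩ (by
        rintro ⟨v', hv', he⟩
        rcases Sym2.eq_iff.1 he with ⟨-, h⟩ | ⟨h, -⟩
        · exact hv' (h ▸ hvU)
        · exact hv' (h ▸ hx₀)))
    have hprod : ∏ x ∈ U, (1 - (w s(x, v) : ℝ)) ≠ 1 := by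
      intro h1
      have := hcoin v hvU
      rw [h1] at this
      have h0 : (wm s(x₀, v) : ℝ) = 0 := by linarith
      exact hv (Subtype.ext h0)
    have : ∃ x ∈ U, w s(x, v) ≠ 0 := by
      by_contra hall
      refine hprod (Finset.prod_eq_one fun x hx => ?_)
      have h0 : w s(x, v) = 0 := by by_contra h; exact hall ⟨x, hx, h⟩
      rw [h0]; simp
    obtain ⟨x, hx, hxv⟩ := this
    have hvP : v ∈ P := by simp only [hP, Finset.mem_filter]; exact ⟨hRN x hx v hvU hxv, x, hx, hxv⟩
    obtain ⟨l, hl⟩ : ∃ l : Fin P.card, P.orderEmbOfFin rfl l = v := by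
      have := Finset.range_orderEmbOfFin P rfl
      have hv' : v ∈ Set.range (P.orderEmbOfFin rfl) := by rw [this]; exact hvP
      exact hv'
    exact ⟨l, hl.symm⟩
  -- domination under `wm`
  have hdom' : ∀ l : Fin P.card,
      (prodBernoulli wm).real {ω : BondConfig (Fin n) | (A.filter fun z => ω ∈ openConn (p l) z).card ≤ j} ≤
        (prodBernoulli wm).real {ω : BondConfig (Fin n) | (A.filter fun z => ω ∈ openConn c z).card ≤ j} := by
    intro l
    have hplU : p l ∉ U := fun h => Finset.disjoint_left.1 hUA h (hpA l)
    rw [← glued_eq_lightness_anchor w wm A U hUA hu₁ hplU j hoff hzero hcoin,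
      ← glued_eq_lightness_anchor w wm A U hUA hu₁ hcU j hoff hzero hcoin]
    exact hdom (p l) (hpA l) (Finset.mem_filter.1 (hpP l)).2
  have key := cil_of_portDomination wm A x₀ j p hpinj hpA hx₀A hd hobs c hdom'
  rw [real_bad_eq_anchor w wm A U hUA hu₁ j hoff hzero hcoin,
    glued_eq_lightness_anchor w wm A U hUA hu₁ hcU j hoff hzero hcoin]
  exact key

/-- **Set-champion stability of a relay-neighboured Steiner set from port domination in the glued graph.**  With the
hypotheses of `setBad_le_glued_of_portDomination` and `c ∈ A`:  `CS_w(U, c)`, i.e.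
`μ_w(c ↮ U, 1 ≤ |π(U)| ≤ j) ≤ μ_w(c ↮ U, |π(c)| ≤ j)`.
[cite: VandenbergHaggstromKahn2005, Thm. 1.5 (p. 7) — via `Theorems.cil_of_portDomination`, `bad_le_glued_iff_setCS`] -/
theorem setCS_of_gluedPortDomination (w : Sym2 (Fin n) → unitInterval) (A U : Finset (Fin n))
    (hUA : Disjoint U A) (c : Fin n) (hcA : c ∈ A) (j : ℕ)
    (hRN : ∀ x ∈ U, ∀ v : Fin n, v ∉ U → w s(x, v) ≠ 0 → v ∈ A)
    (hport : ∃ x ∈ U, ∃ v : Fin n, v ∉ U ∧ w s(x, v) ≠ 0)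
    (hdom : ∀ p ∈ A, (∃ x ∈ U, w s(x, p) ≠ 0) →
      (prodBernoulli w).real {ω : BondConfig (Fin n) | (∀ x ∈ U, ω ∉ openConn p x) ∧
          (A.filter fun z => ω ∈ openConn p z).card ≤ j} +
        (prodBernoulli w).real {ω : BondConfig (Fin n) | (∃ x ∈ U, ω ∈ openConn p x) ∧
          (A.filter fun z => ∃ x ∈ U, ω ∈ openConn x z).card ≤ j} ≤
      (prodBernoulli w).real {ω : BondConfig (Fin n) | (∀ x ∈ U, ω ∉ openConn c x) ∧
          (A.filter fun z => ω ∈ openConn c z).card ≤ j} +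
        (prodBernoulli w).real {ω : BondConfig (Fin n) | (∃ x ∈ U, ω ∈ openConn c x) ∧
          (A.filter fun z => ∃ x ∈ U, ω ∈ openConn x z).card ≤ j}) :
    (prodBernoulli w).real {ω : BondConfig (Fin n) | (∀ x ∈ U, ω ∉ openConn c x) ∧
        1 ≤ (A.filter fun z => ∃ x ∈ U, ω ∈ openConn x z).card ∧
        (A.filter fun z => ∃ x ∈ U, ω ∈ openConn x z).card ≤ j} ≤
      (prodBernoulli w).real {ω : BondConfig (Fin n) | (∀ x ∈ U, ω ∉ openConn c x) ∧
        (A.filter fun z => ω ∈ openConn c z).card ≤ j} := by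
  have hcU : c ∉ U := fun h => Finset.disjoint_left.1 hUA h hcA
  exact (CutObserver.bad_le_glued_iff_setCS w A U c j hcA).2
    (setBad_le_glued_of_portDomination w A U hUA c hcU j hRN hport hdom)

end SetPort

end Summit.CriticalPhenomena.PercolationContinuityZ3.Theorems

end
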